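import Literature.NumberTheory.EllipticCurves.NewformOpenImageProofs
import Literature.NumberTheory.Transcendental.PadicExpBallProofs
import Mathlib.Analysis.Normed.Algebra.MatrixExponential
import Mathlib.Analysis.Matrix.Normed
import Mathlib.NumberTheory.Padics.ProperSpace
import HarnessLib

/-!
# Open image, II: the `ℓ`-adic exponential on the congruence subgroups of `GL₂(ℤ_ℓ)` (proofs file)

Sibling proofs file of `NewformOpenImage.lean` / `NewformOpenImageProofs.lean` (theorems only, no
definitions, no named facts).  The open-image theorem `momose_isOpen_range_galoisRep` (Ribet
1985, §3; Ribet 1977, Thm. (5.7), after Serre) is proved through the `ℓ`-adic Lie algebra of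
the image `G_ℓ ≤ GL₂(ℤ_ℓ)`: "`𝔤_ℓ = 𝔤𝔩₂`, hence `G_ℓ` is open" (Serre, *Abelian `ℓ`-adic
representations*, Ch. IV; Lie correspondence for `ℓ`-adic analytic groups).  Mathlib has no
`ℓ`-adic Lie theory; this file proves the analytic input from scratch, for `2 × 2` matrices
and every prime `ℓ` (including `2`), in the explicit form needed: for every level `s ≥ 3`,
Mathlib's exponential `NormedSpace.exp` restricts to a **bijection**
`exp : ℓˢ M₂(ℤ_ℓ) → Γ(ℓˢ) = 1 + ℓˢ M₂(ℤ_ℓ)` compatible with powers and congruences.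
(The logarithm is never introduced as a series: it is the inverse of this bijection and is
only used through the existence statement `exists_map_eq_exp_smul_map_of_mem`.)

Throughout, sizes are measured entrywise ("boxes" `‖X i j‖ ≤ ℓ^{-k}`, i.e. `X ∈ ℓᵏ M₂(ℤ_ℓ)`),
and the operator norm of `Mathlib.Analysis.Matrix.Normed` (`Matrix.Norms.Operator`) is used
only inside proofs, to invoke Mathlib's `exp_add_of_commute_of_mem_ball` and the continuity
of `exp` on its disc of convergence (radius `≥ ℓ⁻¹`; a matrix in the box of level `s ≥ 3` has
operator norm `≤ 2ℓ^{-s} < ℓ⁻¹`, which is why the uniform threshold is `s ≥ 3`).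

* `OpenImage.box_*` — boxes are closed under sums, products (`levels add`), scalars, powers,
  and limits of series; `box_map_coe_iff`, `exists_eq_smul_map_of_box` — level-`k` boxes are
  `ℓᵏ ι(M₂(ℤ_ℓ))`.
* `OpenImage.le_expSeries_radius_of_normOneClass` — radius `≥ ℓ⁻¹` in any normed `ℚ_ℓ`-algebra
  with `‖1‖ = 1` (Legendre); `hasSum_exp_of_box`, `exp_add_of_box`, `exp_nsmul_of_box`,
  `exp_neg_of_box`, `continuousOn_exp_box`, `continuous_exp_smul_map`.
* `OpenImage.box_exp_sub_sub_exp_sub` — **key estimate**: `A ≡ B (mod ℓ^{s+t})` implies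
  `exp A − A ≡ exp B − B (mod ℓ^{2s+t−1})` (non-commutative telescoping
  `Aⁿ − Bⁿ = Σ Aⁱ(A − B)B^{n−1−i}` and `v_ℓ(n!) ≤ n − 1`); `box_exp_sub_one_sub` —
  `exp A ≡ 1 + A (mod ℓ^{2s−1})`.
* `OpenImage.exp_injOn_box`, `OpenImage.exists_box_exp_eq_of_mem_congruenceSubgroup` — `exp` is
  injective on the box of level `s` and maps it ONTO `ι(Γ(ℓˢ))` (Newton iteration
  `A ↦ A + (y − exp A)` plus compactness of the box).
* Integral form (`a ∈ M₂(ℤ_ℓ)`, `exp (ℓˢ ι(a))`): `exp_smul_map_nsmul`, `exp_pow_succ_smul_map`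
  (raising the level is the `ℓ`-th power map), `exp_smul_map_injective`,
  `exists_mem_congruenceSubgroup_map_eq_exp_smul_map`, `exists_map_eq_exp_smul_map_of_mem`,
  `exists_eq_one_add_smul_add_of_map_eq_exp` (`g = 1 + ℓˢ a + ℓ^{2s−1} r`),
  `map_toZModPow_eq_of_map_eq_exp`, `mem_congruenceSubgroup_of_map_eq_exp`.

Next files: the Lie lattice `Λ(G) = {a | exp (ℓˢ a) ∈ G}` of a closed subgroup, its bracket,
and the `2 × 2` Lie-algebra computation feeding `OpenImage.isOpen_range_of_sl2_meets_of_det`.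

## References

* J.-P. Serre, *Abelian ℓ-adic representations and elliptic curves*, Benjamin 1968, Ch. IV
  (ℓ-adic Lie algebras of Galois images), and *Lie algebras and Lie groups*, LNM 1500, Part II,
  Ch. V §7 (exponential and logarithm on `1 + ℓ M_n(ℤ_ℓ)`). [SerreAbelianLadic1968]
* N. Koblitz, *p-adic Numbers, p-adic Analysis, and Zeta-Functions*, GTM 58, Ch. IV §1
  (radius `ℓ^{-1/(ℓ-1)}`, Legendre's formula).
* K. A. Ribet, *On ℓ-adic representations attached to modular forms II*, Glasgow Math. J. 27
  (1985) 185–194, §3. [Ribet1985]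
-/

noncomputable section

open scoped MatrixGroups NNReal ENNReal Nat
open Matrix Filter Topology NormedSpace

namespace Literature.NumberTheory.EllipticCurves.ModularForms

namespace OpenImage

open Literature.GroupTheory.Index

variable {ℓ : ℕ} [Fact ℓ.Prime]

/-! ### Boxes: entrywise `ℓ`-adic size in `M₂(ℚ_ℓ)` -/

/-- Boxes are closed under addition (ultrametric inequality). [folklore] -/
theorem box_add {k : ℤ} {X Y : Matrix (Fin 2) (Fin 2) ℚ_[ℓ]}
    (hX : ∀ i j, ‖X i j‖ ≤ (ℓ : ℝ) ^ (-k)) (hY : ∀ i j, ‖Y i j‖ ≤ (ℓ : ℝ) ^ (-k)) :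
    ∀ i j, ‖(X + Y) i j‖ ≤ (ℓ : ℝ) ^ (-k) := fun i j ↦
  (IsUltrametricDist.norm_add_le_max _ _).trans (max_le (hX i j) (hY i j))

/-- Boxes are closed under negation. [folklore] -/
theorem box_neg {k : ℤ} {X : Matrix (Fin 2) (Fin 2) ℚ_[ℓ]}
    (hX : ∀ i j, ‖X i j‖ ≤ (ℓ : ℝ) ^ (-k)) : ∀ i j, ‖(-X) i j‖ ≤ (ℓ : ℝ) ^ (-k) := fun i j ↦ by
  rw [Matrix.neg_apply, norm_neg]; exact hX i j

/-- Boxes are closed under subtraction. [folklore] -/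
theorem box_sub {k : ℤ} {X Y : Matrix (Fin 2) (Fin 2) ℚ_[ℓ]}
    (hX : ∀ i j, ‖X i j‖ ≤ (ℓ : ℝ) ^ (-k)) (hY : ∀ i j, ‖Y i j‖ ≤ (ℓ : ℝ) ^ (-k)) :
    ∀ i j, ‖(X - Y) i j‖ ≤ (ℓ : ℝ) ^ (-k) := by
  rw [sub_eq_add_neg]; exact box_add hX (box_neg hY)

/-- `0` lies in every box. [folklore] -/
theorem box_zero (k : ℤ) : ∀ i j, ‖(0 : Matrix (Fin 2) (Fin 2) ℚ_[ℓ]) i j‖ ≤ (ℓ : ℝ) ^ (-k) :=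
  fun i j ↦ by rw [Matrix.zero_apply, norm_zero]; positivity

/-- Boxes decrease with the level. [folklore] -/
theorem box_mono {j k : ℤ} (hjk : j ≤ k) {X : Matrix (Fin 2) (Fin 2) ℚ_[ℓ]}
    (hX : ∀ i j, ‖X i j‖ ≤ (ℓ : ℝ) ^ (-k)) : ∀ i i', ‖X i i'‖ ≤ (ℓ : ℝ) ^ (-j) := fun i i' ↦
  (hX i i').trans (zpow_le_zpow_right₀ (by exact_mod_cast (Fact.out : ℓ.Prime).one_lt.le) (by omega))

/-- Levels add under products. [folklore] -/
theorem box_mul {j k : ℤ} {X Y : Matrix (Fin 2) (Fin 2) ℚ_[ℓ]}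
    (hX : ∀ i i', ‖X i i'‖ ≤ (ℓ : ℝ) ^ (-j)) (hY : ∀ i i', ‖Y i i'‖ ≤ (ℓ : ℝ) ^ (-k)) :
    ∀ i i', ‖(X * Y) i i'‖ ≤ (ℓ : ℝ) ^ (-(j + k)) := by
  intro i i'
  have hℓ : (ℓ : ℝ) ≠ 0 := by exact_mod_cast (Fact.out : ℓ.Prime).ne_zero
  rw [Matrix.mul_apply, neg_add, zpow_add₀ hℓ]
  refine IsUltrametricDist.norm_sum_le_of_forall_le_of_nonneg (by positivity) fun n _ ↦ ?_
  rw [norm_mul]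
  exact mul_le_mul (hX i n) (hY n i') (norm_nonneg _) (by positivity)

/-- A scalar of norm `≤ ℓᵐ` lowers the level by `m`. [folklore] -/
theorem box_smul {k m : ℤ} {c : ℚ_[ℓ]} (hc : ‖c‖ ≤ (ℓ : ℝ) ^ m) {X : Matrix (Fin 2) (Fin 2) ℚ_[ℓ]}
    (hX : ∀ i j, ‖X i j‖ ≤ (ℓ : ℝ) ^ (-k)) : ∀ i j, ‖(c • X) i j‖ ≤ (ℓ : ℝ) ^ (-(k - m)) := by
  intro i j
  have hℓ : (ℓ : ℝ) ≠ 0 := by exact_mod_cast (Fact.out : ℓ.Prime).ne_zero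
  rw [Matrix.smul_apply, smul_eq_mul, norm_mul, neg_sub, sub_eq_add_neg, zpow_add₀ hℓ]
  exact mul_le_mul hc (hX i j) (norm_nonneg _) (by positivity)

/-- `1` lies in the box of level `0`. [folklore] -/
theorem box_one : ∀ i j, ‖(1 : Matrix (Fin 2) (Fin 2) ℚ_[ℓ]) i j‖ ≤ (ℓ : ℝ) ^ (-(0 : ℤ)) := by
  intro i j
  rw [neg_zero, zpow_zero]
  by_cases hij : i = j
  · subst hij; simp
  · simp [Matrix.one_apply_ne hij]

/-- Levels multiply under powers. [folklore] -/
theorem box_pow {k : ℤ} {X : Matrix (Fin 2) (Fin 2) ℚ_[ℓ]} (hX : ∀ i j, ‖X i j‖ ≤ (ℓ : ℝ) ^ (-k)) (n : ℕ) :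
    ∀ i j, ‖(X ^ n) i j‖ ≤ (ℓ : ℝ) ^ (-(n * k)) := by
  induction n with
  | zero => simpa only [Nat.cast_zero, zero_mul, pow_zero] using (box_one (ℓ := ℓ))
  | succ n ih =>
    rw [pow_succ, Nat.cast_succ, add_mul, one_mul]
    exact box_mul ih hX

/-- A sum of matrices in a box lies in the box (the box is a closed subgroup). [folklore] -/
theorem box_of_hasSum {k : ℤ} {f : ℕ → Matrix (Fin 2) (Fin 2) ℚ_[ℓ]} {x : Matrix (Fin 2) (Fin 2) ℚ_[ℓ]}
    (hf : HasSum f x) (h : ∀ n i j, ‖f n i j‖ ≤ (ℓ : ℝ) ^ (-k)) : ∀ i j, ‖x i j‖ ≤ (ℓ : ℝ) ^ (-k) := by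
  intro i j
  have hij : HasSum (fun n ↦ f n i j) (x i j) := Pi.hasSum.1 (Pi.hasSum.1 hf i) j
  rw [← hij.tsum_eq]
  exact IsUltrametricDist.norm_tsum_le_of_forall_le_of_nonneg (by positivity) fun n ↦ h n i j

/-! ### Boxes and integral matrices -/

/-- For an integral matrix `x`, `‖x‖ ≤ ℓ^{-k}` entrywise iff `ℓ^k ∣ x` entrywise. [folklore] -/
theorem box_map_coe_iff {k : ℕ} (x : Matrix (Fin 2) (Fin 2) ℤ_[ℓ]) :
    (∀ i j, ‖(x.map ((↑) : ℤ_[ℓ] → ℚ_[ℓ])) i j‖ ≤ (ℓ : ℝ) ^ (-(k : ℤ))) ↔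
      ∀ i j, (ℓ : ℤ_[ℓ]) ^ k ∣ x i j := by
  refine forall_congr' fun i ↦ forall_congr' fun j ↦ ?_
  rw [Matrix.map_apply, ← PadicInt.norm_def, PadicInt.norm_le_pow_iff_mem_span_pow,
    Ideal.mem_span_singleton]

/-- `ℓ^k • ι(r)` lies in the box of level `k`. [folklore] -/
theorem box_smul_map_coe (k : ℕ) (r : Matrix (Fin 2) (Fin 2) ℤ_[ℓ]) :
    ∀ i j, ‖((ℓ : ℚ_[ℓ]) ^ k • r.map ((↑) : ℤ_[ℓ] → ℚ_[ℓ])) i j‖ ≤ (ℓ : ℝ) ^ (-(k : ℤ)) := by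
  have h : ((ℓ : ℚ_[ℓ]) ^ k • r.map ((↑) : ℤ_[ℓ] → ℚ_[ℓ])) =
      ((ℓ : ℤ_[ℓ]) ^ k • r).map ((↑) : ℤ_[ℓ] → ℚ_[ℓ]) := by
    ext i j; simp
  rw [h, box_map_coe_iff]
  intro i j
  exact ⟨r i j, rfl⟩

/-- A matrix in the box of level `k ≥ 0` is `ℓ^k • ι(r)` for an integral `r`. [folklore] -/
theorem exists_eq_smul_map_of_box {k : ℕ} {X : Matrix (Fin 2) (Fin 2) ℚ_[ℓ]}
    (hX : ∀ i j, ‖X i j‖ ≤ (ℓ : ℝ) ^ (-(k : ℤ))) :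
    ∃ r : Matrix (Fin 2) (Fin 2) ℤ_[ℓ], X = (ℓ : ℚ_[ℓ]) ^ k • r.map ((↑) : ℤ_[ℓ] → ℚ_[ℓ]) := by
  have hℓ : (1 : ℝ) ≤ ℓ := by exact_mod_cast (Fact.out : ℓ.Prime).one_lt.le
  have hint : ∀ i j, ‖X i j‖ ≤ 1 := fun i j ↦
    (hX i j).trans (zpow_le_one_of_nonpos₀ hℓ (by omega))
  set x : Matrix (Fin 2) (Fin 2) ℤ_[ℓ] := Matrix.of fun i j ↦ ⟨X i j, hint i j⟩ with hx
  have hxX : x.map ((↑) : ℤ_[ℓ] → ℚ_[ℓ]) = X := by ext i j; simp [hx]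
  rw [← hxX, box_map_coe_iff] at hX
  choose r hr using hX
  refine ⟨Matrix.of fun i j ↦ r i j, ?_⟩
  ext i j
  have := hr i j
  simp only [Matrix.smul_apply, Matrix.map_apply, Matrix.of_apply, smul_eq_mul]
  rw [← hxX, Matrix.map_apply, this]
  simp

/-! ### Scalars: `‖1/n!‖_ℓ ≤ ℓ^{n-1}` -/

/-- `‖1/n!‖_ℓ ≤ ℓ^{n−1}` (Legendre). [folklore] -/
theorem norm_inv_factorial_le (n : ℕ) : ‖(n !⁻¹ : ℚ_[ℓ])‖ ≤ (ℓ : ℝ) ^ (((n - 1 : ℕ)) : ℤ) := by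
  have : ((n !⁻¹ : ℚ_[ℓ])) = ((n ! : ℕ) : ℚ_[ℓ])⁻¹ := by norm_cast
  rw [this, zpow_natCast]
  exact Transcendental.PadicExp.norm_inv_natCast_factorial_padic_le n

/-! ### The exponential series in a normed `ℚ_ℓ`-algebra: the disc `‖a‖ < ℓ⁻¹` -/

/-- `ℓ⁻¹ ≤` radius of convergence of the exponential series of a normed `ℚ_ℓ`-algebra with
`‖1‖ = 1`. [folklore] -/
theorem le_expSeries_radius_of_normOneClass {𝔸 : Type*} [NormedRing 𝔸] [NormedAlgebra ℚ_[ℓ] 𝔸]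
    [NormOneClass 𝔸] : (((ℓ : ℝ≥0)⁻¹ : ℝ≥0) : ℝ≥0∞) ≤ (expSeries ℚ_[ℓ] 𝔸).radius := by
  have hp : ℓ.Prime := Fact.out
  have hℓ : (0 : ℝ) < ℓ := by exact_mod_cast hp.pos
  refine FormalMultilinearSeries.le_radius_of_bound _ 1 fun n => ?_
  have h1 : ‖expSeries ℚ_[ℓ] 𝔸 n‖ ≤ (ℓ : ℝ) ^ (n - 1) := by
    rw [expSeries]
    refine (norm_smul_le (n !⁻¹ : ℚ_[ℓ]) (ContinuousMultilinearMap.mkPiAlgebraFin ℚ_[ℓ] n 𝔸)).trans ?_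
    rw [ContinuousMultilinearMap.norm_mkPiAlgebraFin, mul_one]
    have : ((n !⁻¹ : ℚ_[ℓ])) = ((n ! : ℕ) : ℚ_[ℓ])⁻¹ := by norm_cast
    rw [this]
    exact Transcendental.PadicExp.norm_inv_natCast_factorial_padic_le n
  have h2 : (((ℓ : ℝ≥0)⁻¹ : ℝ≥0) : ℝ) ^ n = ((ℓ : ℝ) ^ n)⁻¹ := by
    rw [NNReal.coe_inv, NNReal.coe_natCast, inv_pow]
  rw [h2]
  calc ‖expSeries ℚ_[ℓ] 𝔸 n‖ * ((ℓ : ℝ) ^ n)⁻¹ ≤ (ℓ : ℝ) ^ (n - 1) * ((ℓ : ℝ) ^ n)⁻¹ :=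
        mul_le_mul_of_nonneg_right h1 (by positivity)
    _ ≤ (ℓ : ℝ) ^ n * ((ℓ : ℝ) ^ n)⁻¹ := by
        gcongr
        · exact_mod_cast hp.one_lt.le
        · exact Nat.sub_le n 1
    _ = 1 := mul_inv_cancel₀ (by positivity)

/-- Elements of norm `< ℓ⁻¹` lie in the disc of convergence. [folklore] -/
theorem mem_eball_expSeries_radius {𝔸 : Type*} [NormedRing 𝔸] [NormedAlgebra ℚ_[ℓ] 𝔸]
    [NormOneClass 𝔸] {a : 𝔸} (ha : ‖a‖ < (ℓ : ℝ)⁻¹) :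
    a ∈ Metric.eball (0 : 𝔸) (expSeries ℚ_[ℓ] 𝔸).radius := by
  rw [Metric.mem_eball, edist_zero_right]
  refine lt_of_lt_of_le ?_ le_expSeries_radius_of_normOneClass
  rw [enorm_eq_nnnorm, ENNReal.coe_lt_coe, ← NNReal.coe_lt_coe, coe_nnnorm, NNReal.coe_inv,
    NNReal.coe_natCast]
  exact ha

section OpNorm

open scoped Matrix.Norms.Operator

set_option backward.isDefEq.respectTransparency false

/-- In the operator norm, a matrix in the box of level `s ≥ 3` has norm `< ℓ⁻¹`. [folklore] -/
theorem linfty_opNorm_lt_of_box {s : ℕ} (hs : 3 ≤ s) {A : Matrix (Fin 2) (Fin 2) ℚ_[ℓ]}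
    (hA : ∀ i j, ‖A i j‖ ≤ (ℓ : ℝ) ^ (-(s : ℤ))) : ‖A‖ < (ℓ : ℝ)⁻¹ := by
  have hp : ℓ.Prime := Fact.out
  have hℓ : (0 : ℝ) < ℓ := by exact_mod_cast hp.pos
  have hℓ1 : (1 : ℝ) ≤ ℓ := by exact_mod_cast hp.one_lt.le
  rw [Matrix.linfty_opNorm_def]
  have hrow : ∀ i, (∑ j, ‖A i j‖₊ : ℝ≥0) ≤ ⟨2 * (ℓ : ℝ) ^ (-(s : ℤ)), by positivity⟩ := by
    intro i
    rw [← NNReal.coe_le_coe, NNReal.coe_sum]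
    calc ∑ j, ((‖A i j‖₊ : ℝ≥0) : ℝ) = ∑ j, ‖A i j‖ := by simp
      _ ≤ ∑ _j : Fin 2, (ℓ : ℝ) ^ (-(s : ℤ)) := Finset.sum_le_sum fun j _ ↦ hA i j
      _ = 2 * (ℓ : ℝ) ^ (-(s : ℤ)) := by simp [two_mul]
  calc (((Finset.univ : Finset (Fin 2)).sup fun i ↦ ∑ j, ‖A i j‖₊ : ℝ≥0) : ℝ)
      ≤ 2 * (ℓ : ℝ) ^ (-(s : ℤ)) := by
        have := Finset.sup_le (s := (Finset.univ : Finset (Fin 2))) fun i _ ↦ hrow i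
        exact_mod_cast this
    _ < (ℓ : ℝ)⁻¹ := by
        have h2 : (2 : ℝ) ≤ ℓ := by exact_mod_cast hp.two_le
        calc 2 * (ℓ : ℝ) ^ (-(s : ℤ)) ≤ ℓ * (ℓ : ℝ) ^ (-(3 : ℤ)) :=
              mul_le_mul h2 (zpow_le_zpow_right₀ hℓ1 (by omega)) (by positivity) (by positivity)
          _ = (ℓ : ℝ)⁻¹ * (ℓ : ℝ)⁻¹ := by field_simp
          _ < (ℓ : ℝ)⁻¹ * 1 := by
              refine mul_lt_mul_of_pos_left ?_ (by positivity)
              exact inv_lt_one_of_one_lt₀ (by exact_mod_cast hp.one_lt)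
          _ = (ℓ : ℝ)⁻¹ := mul_one _

/-- … hence lies in the disc of convergence of the exponential series. [folklore] -/
theorem mem_eball_of_box {s : ℕ} (hs : 3 ≤ s) {A : Matrix (Fin 2) (Fin 2) ℚ_[ℓ]}
    (hA : ∀ i j, ‖A i j‖ ≤ (ℓ : ℝ) ^ (-(s : ℤ))) :
    A ∈ Metric.eball (0 : Matrix (Fin 2) (Fin 2) ℚ_[ℓ])
      (expSeries ℚ_[ℓ] (Matrix (Fin 2) (Fin 2) ℚ_[ℓ])).radius :=
  mem_eball_expSeries_radius (linfty_opNorm_lt_of_box hs hA)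

/-- **The exponential series on the box of level `s ≥ 3`.** [folklore] -/
theorem hasSum_exp_of_box {s : ℕ} (hs : 3 ≤ s) {A : Matrix (Fin 2) (Fin 2) ℚ_[ℓ]}
    (hA : ∀ i j, ‖A i j‖ ≤ (ℓ : ℝ) ^ (-(s : ℤ))) :
    HasSum (fun n ↦ (n !⁻¹ : ℚ_[ℓ]) • A ^ n) (exp A) :=
  expSeries_hasSum_exp_of_mem_ball' A (mem_eball_of_box hs hA)

/-- `exp (A + B) = exp A * exp B` for commuting `A, B` in the box of level `s ≥ 3`. [folklore] -/
theorem exp_add_of_box {s : ℕ} (hs : 3 ≤ s) {A B : Matrix (Fin 2) (Fin 2) ℚ_[ℓ]} (hAB : Commute A B)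
    (hA : ∀ i j, ‖A i j‖ ≤ (ℓ : ℝ) ^ (-(s : ℤ))) (hB : ∀ i j, ‖B i j‖ ≤ (ℓ : ℝ) ^ (-(s : ℤ))) :
    exp (A + B) = exp A * exp B :=
  exp_add_of_commute_of_mem_ball hAB (mem_eball_of_box hs hA) (mem_eball_of_box hs hB)

/-- `exp (n • A) = (exp A)ⁿ` on the box of level `s ≥ 3`. [folklore] -/
theorem exp_nsmul_of_box {s : ℕ} (hs : 3 ≤ s) {A : Matrix (Fin 2) (Fin 2) ℚ_[ℓ]}
    (hA : ∀ i j, ‖A i j‖ ≤ (ℓ : ℝ) ^ (-(s : ℤ))) (n : ℕ) : exp (n • A) = exp A ^ n := by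
  induction n with
  | zero => simp [exp_zero]
  | succ n ih =>
    have hnA : ∀ i j, ‖(n • A) i j‖ ≤ (ℓ : ℝ) ^ (-(s : ℤ)) := by
      intro i j
      rw [Matrix.smul_apply, nsmul_eq_mul, norm_mul]
      have hn : ‖(n : ℚ_[ℓ])‖ ≤ 1 := by
        have := Padic.norm_int_le_one (p := ℓ) n
        rwa [Int.cast_natCast] at this
      exact (mul_le_of_le_one_left (norm_nonneg _) hn).trans (hA i j)
    rw [succ_nsmul, exp_add_of_box hs ((Commute.refl A).smul_left n) hnA hA, ih, pow_succ]

/-- `exp A` is a unit, with inverse `exp (-A)`, on the box of level `s ≥ 3`. [folklore] -/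
theorem exp_neg_of_box {s : ℕ} (hs : 3 ≤ s) {A : Matrix (Fin 2) (Fin 2) ℚ_[ℓ]}
    (hA : ∀ i j, ‖A i j‖ ≤ (ℓ : ℝ) ^ (-(s : ℤ))) : exp (-A) * exp A = 1 ∧ exp A * exp (-A) = 1 := by
  have h1 := exp_add_of_box hs ((Commute.refl A).neg_left) (box_neg hA) hA
  have h2 := exp_add_of_box hs ((Commute.refl A).neg_right) hA (box_neg hA)
  rw [neg_add_cancel, exp_zero] at h1
  rw [add_neg_cancel, exp_zero] at h2
  exact ⟨h1.symm, h2.symm⟩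

/-- `exp` is continuous on the box of level `s ≥ 3`. [folklore] -/
theorem continuousOn_exp_box {s : ℕ} (hs : 3 ≤ s) :
    ContinuousOn (exp : Matrix (Fin 2) (Fin 2) ℚ_[ℓ] → Matrix (Fin 2) (Fin 2) ℚ_[ℓ])
      {A | ∀ i j, ‖A i j‖ ≤ (ℓ : ℝ) ^ (-(s : ℤ))} :=
  (continuousOn_exp (𝕂 := ℚ_[ℓ])).mono fun _ hA ↦ mem_eball_of_box hs hA

end OpNorm

/-- `b ↦ exp (ℓˢ ι(b))` is continuous on `M₂(ℤ_ℓ)` (`s ≥ 3`). [folklore] -/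
theorem continuous_exp_smul_map {s : ℕ} (hs : 3 ≤ s) :
    Continuous (fun b : Matrix (Fin 2) (Fin 2) ℤ_[ℓ] ↦
      exp ((ℓ : ℚ_[ℓ]) ^ s • b.map ((↑) : ℤ_[ℓ] → ℚ_[ℓ]))) := by
  have hc : Continuous (fun b : Matrix (Fin 2) (Fin 2) ℤ_[ℓ] ↦ (ℓ : ℚ_[ℓ]) ^ s • b.map ((↑) : ℤ_[ℓ] → ℚ_[ℓ])) :=
    (continuous_const_smul ((ℓ : ℚ_[ℓ]) ^ s)).comp (continuous_id.matrix_map continuous_subtype_val)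
  exact (continuousOn_exp_box hs).comp_continuous hc fun b ↦ box_smul_map_coe s b

/-! ### The key estimate: `exp` moves `exp A − A` by less than it moves `A` -/

/-- Boxes are closed under finite sums. [folklore] -/
theorem box_finset_sum {k : ℤ} {ι : Type*} (S : Finset ι) {f : ι → Matrix (Fin 2) (Fin 2) ℚ_[ℓ]}
    (h : ∀ n ∈ S, ∀ i j, ‖f n i j‖ ≤ (ℓ : ℝ) ^ (-k)) : ∀ i j, ‖(∑ n ∈ S, f n) i j‖ ≤ (ℓ : ℝ) ^ (-k) := by
  classical
  induction S using Finset.induction_on with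
  | empty => simpa using box_zero (ℓ := ℓ) k
  | insert a S ha ih =>
    rw [Finset.sum_insert ha]
    exact box_add (h a (Finset.mem_insert_self a S)) (ih fun n hn ↦ h n (Finset.mem_insert_of_mem hn))

/-- Non-commutative telescoping: `aⁿ − bⁿ = Σ_{i<n} aⁱ (a − b) b^{n−1−i}`. [folklore] -/
theorem pow_sub_pow_eq_sum {R : Type*} [Ring R] (a b : R) (n : ℕ) :
    a ^ n - b ^ n = ∑ i ∈ Finset.range n, a ^ i * (a - b) * b ^ (n - 1 - i) := by
  induction n with
  | zero => simp
  | succ n ih =>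
    rw [Finset.sum_range_succ, Nat.add_sub_cancel, Nat.sub_self, pow_zero, mul_one]
    have h : ∑ i ∈ Finset.range n, a ^ i * (a - b) * b ^ (n - i) =
        (∑ i ∈ Finset.range n, a ^ i * (a - b) * b ^ (n - 1 - i)) * b := by
      rw [Finset.sum_mul]
      refine Finset.sum_congr rfl fun i hi ↦ ?_
      rw [Finset.mem_range] at hi
      rw [mul_assoc (a ^ i * (a - b)), ← pow_succ, show n - 1 - i + 1 = n - i by omega]
    rw [h, ← ih]
    noncomm_ring

/-- **Key estimate.**  For `A, B` in the box of level `s ≥ 3` with `A ≡ B (mod ℓ^{s+t})`: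
`(exp A − A) ≡ (exp B − B) (mod ℓ^{2s+t−1})` — the terms `(Aⁿ − Bⁿ)/n!`, `n ≥ 2`, of the
difference are `≡ 0`, by telescoping and Legendre's bound `v_ℓ(n!) ≤ n − 1`. This congruence
drives injectivity and (by Newton iteration) surjectivity of `exp : ℓˢ M₂(ℤ_ℓ) → Γ(ℓˢ)`.
[folklore] -/
theorem box_exp_sub_sub_exp_sub {s t : ℕ} (hs : 3 ≤ s) {A B : Matrix (Fin 2) (Fin 2) ℚ_[ℓ]}
    (hA : ∀ i j, ‖A i j‖ ≤ (ℓ : ℝ) ^ (-(s : ℤ))) (hB : ∀ i j, ‖B i j‖ ≤ (ℓ : ℝ) ^ (-(s : ℤ)))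
    (hAB : ∀ i j, ‖(A - B) i j‖ ≤ (ℓ : ℝ) ^ (-((s + t : ℕ) : ℤ))) :
    ∀ i j, ‖((exp A - A) - (exp B - B)) i j‖ ≤ (ℓ : ℝ) ^ (-((2 * s + t - 1 : ℕ) : ℤ)) := by
  classical
  set f : ℕ → Matrix (Fin 2) (Fin 2) ℚ_[ℓ] := fun n ↦ (n !⁻¹ : ℚ_[ℓ]) • (A ^ n - B ^ n) with hf
  have hdiff : HasSum f (exp A - exp B) := by
    have h := (hasSum_exp_of_box hs hA).sub (hasSum_exp_of_box hs hB)
    simpa only [hf, smul_sub] using h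
  have hupd : HasSum (Function.update f 1 0) ((exp A - A) - (exp B - B)) := by
    have h := hdiff.update 1 0
    have hf1 : f 1 = A - B := by simp [hf]
    rw [hf1] at h
    have he : exp A - A - (exp B - B) = 0 - (A - B) + (exp A - exp B) := by abel
    rw [he]
    exact h
  refine box_of_hasSum hupd fun n ↦ ?_
  rcases eq_or_ne n 1 with rfl | hn1
  · rw [Function.update_self]; exact box_zero _
  rw [Function.update_of_ne hn1]
  rcases Nat.lt_or_ge n 1 with hn0 | hn2
  · obtain rfl : n = 0 := by omega
    intro i j
    simp only [hf, pow_zero, sub_self, smul_zero, Matrix.zero_apply, norm_zero]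
    positivity
  have hn2 : 2 ≤ n := by omega
  -- the term `(Aⁿ - Bⁿ)/n!`, `n ≥ 2`
  have hpow : ∀ i j, ‖(A ^ n - B ^ n) i j‖ ≤ (ℓ : ℝ) ^ (-((n * s + t : ℕ) : ℤ)) := by
    rw [pow_sub_pow_eq_sum]
    refine box_finset_sum _ fun m hm ↦ ?_
    rw [Finset.mem_range] at hm
    have h1 := box_mul (box_mul (box_pow hA m) hAB) (box_pow hB (n - 1 - m))
    have he : ((m : ℤ) * s + ((s + t : ℕ) : ℤ)) + ((n - 1 - m : ℕ) : ℤ) * s = ((n * s + t : ℕ) : ℤ) := by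
      have : m + 1 + (n - 1 - m) = n := by omega
      push_cast [Nat.cast_sub (show m ≤ n - 1 by omega), Nat.cast_sub (show 1 ≤ n by omega)]
      nlinarith [this]
    rw [he] at h1
    exact h1
  have hterm := box_smul (norm_inv_factorial_le (ℓ := ℓ) n) hpow
  refine box_mono ?_ hterm
  have h2 : ((2 * s + t - 1 : ℕ) : ℤ) = 2 * s + t - 1 := by push_cast [Nat.cast_sub (show 1 ≤ 2 * s + t by omega)]; ring
  have h3 : ((n - 1 : ℕ) : ℤ) = n - 1 := by push_cast [Nat.cast_sub (show 1 ≤ n by omega)]; ring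
  rw [h2, h3]
  push_cast
  nlinarith [mul_nonneg (sub_nonneg.2 (show (2 : ℤ) ≤ n by exact_mod_cast hn2))
    (sub_nonneg.2 (show (1 : ℤ) ≤ s by exact_mod_cast (by omega : 1 ≤ s)))]

/-- **First-order congruence.**  `exp A ≡ 1 + A (mod ℓ^{2s−1})` on the box of level `s ≥ 3`.
[folklore] -/
theorem box_exp_sub_one_sub {s : ℕ} (hs : 3 ≤ s) {A : Matrix (Fin 2) (Fin 2) ℚ_[ℓ]}
    (hA : ∀ i j, ‖A i j‖ ≤ (ℓ : ℝ) ^ (-(s : ℤ))) :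
    ∀ i j, ‖(exp A - 1 - A) i j‖ ≤ (ℓ : ℝ) ^ (-((2 * s - 1 : ℕ) : ℤ)) := by
  have h := box_exp_sub_sub_exp_sub (t := 0) hs hA (box_zero _) (by simpa using hA)
  rw [exp_zero, sub_zero, Nat.add_zero] at h
  have he : exp A - 1 - A = (exp A - A) - 1 := by abel
  rw [he]
  exact h

/-- `exp A ≡ 1 (mod ℓˢ)` on the box of level `s ≥ 3`. [folklore] -/
theorem box_exp_sub_one {s : ℕ} (hs : 3 ≤ s) {A : Matrix (Fin 2) (Fin 2) ℚ_[ℓ]}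
    (hA : ∀ i j, ‖A i j‖ ≤ (ℓ : ℝ) ^ (-(s : ℤ))) :
    ∀ i j, ‖(exp A - 1) i j‖ ≤ (ℓ : ℝ) ^ (-(s : ℤ)) := by
  have h := box_add (box_mono (j := s) (by omega) (box_exp_sub_one_sub hs hA)) hA
  rwa [sub_add_cancel] at h

/-- **`exp` maps the box of level `s ≥ 3` into `ι(Γ(ℓˢ))`.** [folklore] -/
theorem exists_mem_congruenceSubgroup_map_eq_exp {s : ℕ} (hs : 3 ≤ s) {A : Matrix (Fin 2) (Fin 2) ℚ_[ℓ]}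
    (hA : ∀ i j, ‖A i j‖ ≤ (ℓ : ℝ) ^ (-(s : ℤ))) :
    ∃ g ∈ GL2.congruenceSubgroup (p := ℓ) s,
      (g : Matrix (Fin 2) (Fin 2) ℤ_[ℓ]).map ((↑) : ℤ_[ℓ] → ℚ_[ℓ]) = exp A := by
  obtain ⟨h1, h2⟩ := exp_neg_of_box hs hA
  set u : GL (Fin 2) ℚ_[ℓ] := ⟨exp A, exp (-A), h2, h1⟩ with hu
  have hbox : ∀ i j, ‖(u : Matrix (Fin 2) (Fin 2) ℚ_[ℓ]) i j - (1 : Matrix (Fin 2) (Fin 2) ℚ_[ℓ]) i j‖ ≤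
      (ℓ : ℝ) ^ (-(s : ℤ)) := fun i j ↦ by
    rw [← Matrix.sub_apply]; exact box_exp_sub_one hs hA i j
  obtain ⟨g, hg, hgu⟩ := exists_map_eq_of_mem_box (by omega) hbox
  refine ⟨g, hg, ?_⟩
  rw [← coe_map_coeRingHom, hgu]

/-- **`exp` is injective on the box of level `s ≥ 3`.** [folklore] -/
theorem exp_injOn_box {s : ℕ} (hs : 3 ≤ s) {A B : Matrix (Fin 2) (Fin 2) ℚ_[ℓ]}
    (hA : ∀ i j, ‖A i j‖ ≤ (ℓ : ℝ) ^ (-(s : ℤ))) (hB : ∀ i j, ‖B i j‖ ≤ (ℓ : ℝ) ^ (-(s : ℤ)))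
    (h : exp A = exp B) : A = B := by
  have hp : ℓ.Prime := Fact.out
  -- `A ≡ B` to every depth
  have key : ∀ t : ℕ, ∀ i j, ‖(A - B) i j‖ ≤ (ℓ : ℝ) ^ (-((s + t : ℕ) : ℤ)) := by
    intro t
    induction t with
    | zero => simpa using box_sub hA hB
    | succ t ih =>
      have h1 := box_exp_sub_sub_exp_sub hs hA hB ih
      rw [h] at h1
      have he : exp B - A - (exp B - B) = -(A - B) := by abel
      rw [he] at h1
      have h2 := box_neg h1
      rw [neg_neg] at h2
      exact box_mono (by push_cast [Nat.cast_sub (show 1 ≤ 2 * s + t by omega)]; omega) h2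
  ext i j
  rw [← sub_eq_zero, ← Matrix.sub_apply, ← norm_le_zero_iff]
  refine le_of_forall_pos_lt_add fun ε hε ↦ ?_
  rw [zero_add]
  obtain ⟨t, ht⟩ : ∃ t : ℕ, ((ℓ : ℝ)⁻¹) ^ t < ε :=
    exists_pow_lt_of_lt_one hε (inv_lt_one_of_one_lt₀ (by exact_mod_cast hp.one_lt))
  refine (key t i j).trans_lt (lt_of_le_of_lt ?_ ht)
  rw [← zpow_natCast, _root_.inv_zpow', zpow_le_zpow_iff_right₀ (by exact_mod_cast hp.one_lt)]
  push_cast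
  omega

/-- The box of level `s` is compact. [folklore] -/
theorem isCompact_box (s : ℕ) :
    IsCompact {A : Matrix (Fin 2) (Fin 2) ℚ_[ℓ] | ∀ i j, ‖A i j‖ ≤ (ℓ : ℝ) ^ (-(s : ℤ))} := by
  have h : {A : Matrix (Fin 2) (Fin 2) ℚ_[ℓ] | ∀ i j, ‖A i j‖ ≤ (ℓ : ℝ) ^ (-(s : ℤ))} =
      (Metric.closedBall (0 : ℚ_[ℓ]) ((ℓ : ℝ) ^ (-(s : ℤ)))).matrix := by
    ext A
    simp only [Set.mem_setOf_eq, Set.mem_matrix, mem_closedBall_zero_iff]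
  rw [h]
  exact (isCompact_closedBall _ _).matrix

/-- Entrywise small differences give convergence in `M₂(ℚ_ℓ)`. [folklore] -/
theorem tendsto_of_box_sub {x : ℕ → Matrix (Fin 2) (Fin 2) ℚ_[ℓ]} {y : Matrix (Fin 2) (Fin 2) ℚ_[ℓ]} {s : ℕ}
    (h : ∀ t, ∀ i j, ‖(x t - y) i j‖ ≤ (ℓ : ℝ) ^ (-((s + t : ℕ) : ℤ))) :
    Tendsto x atTop (𝓝 y) := by
  have hp : ℓ.Prime := Fact.out
  refine tendsto_pi_nhds.2 fun i ↦ tendsto_pi_nhds.2 fun j ↦ ?_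
  rw [Metric.tendsto_atTop]
  intro ε hε
  obtain ⟨t, ht⟩ : ∃ t : ℕ, ((ℓ : ℝ)⁻¹) ^ t < ε :=
    exists_pow_lt_of_lt_one hε (inv_lt_one_of_one_lt₀ (by exact_mod_cast hp.one_lt))
  refine ⟨t, fun n hn ↦ ?_⟩
  rw [dist_eq_norm, ← Matrix.sub_apply]
  refine (h n i j).trans_lt (lt_of_le_of_lt ?_ ht)
  rw [← zpow_natCast, _root_.inv_zpow', zpow_le_zpow_iff_right₀ (by exact_mod_cast hp.one_lt)]
  push_cast
  omega

/-- **`exp` maps the box of level `s ≥ 3` ONTO `ι(Γ(ℓˢ))`** (Newton iteration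
`A ↦ A + (y − exp A)` and compactness). [folklore] -/
theorem exists_box_exp_eq_of_mem_congruenceSubgroup {s : ℕ} (hs : 3 ≤ s) {g : GL (Fin 2) ℤ_[ℓ]}
    (hg : g ∈ GL2.congruenceSubgroup (p := ℓ) s) :
    ∃ A : Matrix (Fin 2) (Fin 2) ℚ_[ℓ], (∀ i j, ‖A i j‖ ≤ (ℓ : ℝ) ^ (-(s : ℤ))) ∧
      exp A = (g : Matrix (Fin 2) (Fin 2) ℤ_[ℓ]).map ((↑) : ℤ_[ℓ] → ℚ_[ℓ]) := by
  set Y : Matrix (Fin 2) (Fin 2) ℚ_[ℓ] := (g : Matrix (Fin 2) (Fin 2) ℤ_[ℓ]).map ((↑) : ℤ_[ℓ] → ℚ_[ℓ]) with hY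
  -- `Y - 1` lies in the box
  have hY1 : ∀ i j, ‖(Y - 1) i j‖ ≤ (ℓ : ℝ) ^ (-(s : ℤ)) := by
    obtain ⟨a, ha⟩ := exists_eq_one_add_smul_of_mem hg
    have : Y - 1 = (ℓ : ℚ_[ℓ]) ^ s • a.map ((↑) : ℤ_[ℓ] → ℚ_[ℓ]) := by
      rw [hY, ha]
      ext i j
      by_cases hij : i = j
      · subst hij; simp
      · simp [Matrix.one_apply_ne hij]
    rw [this]
    exact box_smul_map_coe s a
  -- Newton iteration: approximate solutions to every depth
  have approx : ∀ t : ℕ, ∃ A : Matrix (Fin 2) (Fin 2) ℚ_[ℓ], (∀ i j, ‖A i j‖ ≤ (ℓ : ℝ) ^ (-(s : ℤ))) ∧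
      ∀ i j, ‖(exp A - Y) i j‖ ≤ (ℓ : ℝ) ^ (-((s + t : ℕ) : ℤ)) := by
    intro t
    induction t with
    | zero =>
      refine ⟨Y - 1, hY1, ?_⟩
      have he : exp (Y - 1) - Y = exp (Y - 1) - 1 - (Y - 1) := by abel
      rw [he, Nat.add_zero]
      exact box_mono (by push_cast [Nat.cast_sub (show 1 ≤ 2 * s by omega)]; omega)
        (box_exp_sub_one_sub hs hY1)
    | succ t ih =>
      obtain ⟨A, hA, hAY⟩ := ih
      have hA' : ∀ i j, ‖(A + (Y - exp A)) i j‖ ≤ (ℓ : ℝ) ^ (-(s : ℤ)) := by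
        refine box_add hA (box_mono (j := (s : ℤ)) (k := ((s + t : ℕ) : ℤ)) (by push_cast; omega) ?_)
        have := box_neg hAY
        rwa [neg_sub] at this
      refine ⟨A + (Y - exp A), hA', ?_⟩
      have hdiff : ∀ i j, ‖((A + (Y - exp A)) - A) i j‖ ≤ (ℓ : ℝ) ^ (-((s + t : ℕ) : ℤ)) := by
        rw [add_sub_cancel_left]
        have := box_neg hAY
        rwa [neg_sub] at this
      have hk := box_exp_sub_sub_exp_sub hs hA' hA hdiff
      have he : exp (A + (Y - exp A)) - Y =
          (exp (A + (Y - exp A)) - (A + (Y - exp A))) - (exp A - A) := by abel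
      rw [he]
      exact box_mono (by push_cast [Nat.cast_sub (show 1 ≤ 2 * s + t by omega)]; omega) hk
  choose x hx hxY using approx
  -- the image of the (compact) box under `exp` is closed and `Y` is a limit of points of it
  have hclosed : IsClosed (exp '' {A : Matrix (Fin 2) (Fin 2) ℚ_[ℓ] | ∀ i j, ‖A i j‖ ≤ (ℓ : ℝ) ^ (-(s : ℤ))}) :=
    ((isCompact_box s).image_of_continuousOn (continuousOn_exp_box hs)).isClosed
  have hmem : Y ∈ exp '' {A : Matrix (Fin 2) (Fin 2) ℚ_[ℓ] | ∀ i j, ‖A i j‖ ≤ (ℓ : ℝ) ^ (-(s : ℤ))} :=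
    hclosed.mem_of_tendsto (tendsto_of_box_sub hxY)
      (Eventually.of_forall fun t ↦ Set.mem_image_of_mem _ (hx t))
  obtain ⟨A, hA, hAY⟩ := hmem
  exact ⟨A, hA, hAY⟩

/-! ### Integral form: `exp (ℓˢ ι(a))` for `a ∈ M₂(ℤ_ℓ)` -/

/-- `ι(n • a) = n • ι(a)`. [folklore] -/
theorem map_coe_nsmul (n : ℕ) (a : Matrix (Fin 2) (Fin 2) ℤ_[ℓ]) :
    (n • a).map ((↑) : ℤ_[ℓ] → ℚ_[ℓ]) = n • a.map ((↑) : ℤ_[ℓ] → ℚ_[ℓ]) := by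
  ext i j
  rw [Matrix.map_apply, Matrix.smul_apply, Matrix.smul_apply, Matrix.map_apply, nsmul_eq_mul, nsmul_eq_mul,
    PadicInt.coe_mul, PadicInt.coe_natCast]

/-- `exp (ℓˢ ι(n • a)) = exp (ℓˢ ι(a))ⁿ` (`s ≥ 3`). [folklore] -/
theorem exp_smul_map_nsmul {s : ℕ} (hs : 3 ≤ s) (a : Matrix (Fin 2) (Fin 2) ℤ_[ℓ]) (n : ℕ) :
    exp ((ℓ : ℚ_[ℓ]) ^ s • (n • a).map ((↑) : ℤ_[ℓ] → ℚ_[ℓ])) =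
      exp ((ℓ : ℚ_[ℓ]) ^ s • a.map ((↑) : ℤ_[ℓ] → ℚ_[ℓ])) ^ n := by
  rw [map_coe_nsmul, smul_comm, exp_nsmul_of_box hs (box_smul_map_coe s a)]

/-- `exp (ℓ^{s+1} ι(a)) = exp (ℓˢ ι(a))^ℓ` (`s ≥ 3`): raising the level is the `ℓ`-th power map.
[folklore] -/
theorem exp_pow_succ_smul_map {s : ℕ} (hs : 3 ≤ s) (a : Matrix (Fin 2) (Fin 2) ℤ_[ℓ]) :
    exp ((ℓ : ℚ_[ℓ]) ^ (s + 1) • a.map ((↑) : ℤ_[ℓ] → ℚ_[ℓ])) =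
      exp ((ℓ : ℚ_[ℓ]) ^ s • a.map ((↑) : ℤ_[ℓ] → ℚ_[ℓ])) ^ ℓ := by
  rw [← exp_nsmul_of_box hs (box_smul_map_coe s a), pow_succ', mul_smul, Nat.cast_smul_eq_nsmul]

/-- `exp (ℓˢ ι(·))` is injective on `M₂(ℤ_ℓ)` (`s ≥ 3`). [folklore] -/
theorem exp_smul_map_injective {s : ℕ} (hs : 3 ≤ s) :
    Function.Injective (fun a : Matrix (Fin 2) (Fin 2) ℤ_[ℓ] ↦
      exp ((ℓ : ℚ_[ℓ]) ^ s • a.map ((↑) : ℤ_[ℓ] → ℚ_[ℓ]))) := by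
  intro a b h
  have h1 := exp_injOn_box hs (box_smul_map_coe s a) (box_smul_map_coe s b) h
  have hℓ : (ℓ : ℚ_[ℓ]) ^ s ≠ 0 := pow_ne_zero _ (by exact_mod_cast (Fact.out : ℓ.Prime).ne_zero)
  exact Matrix.map_injective Subtype.val_injective (smul_right_injective _ hℓ h1)

/-- Every `a ∈ M₂(ℤ_ℓ)` gives an element `g ∈ Γ(ℓˢ)` with `ι(g) = exp (ℓˢ ι(a))` (`s ≥ 3`).
[folklore] -/
theorem exists_mem_congruenceSubgroup_map_eq_exp_smul_map {s : ℕ} (hs : 3 ≤ s)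
    (a : Matrix (Fin 2) (Fin 2) ℤ_[ℓ]) :
    ∃ g ∈ GL2.congruenceSubgroup (p := ℓ) s, (g : Matrix (Fin 2) (Fin 2) ℤ_[ℓ]).map ((↑) : ℤ_[ℓ] → ℚ_[ℓ]) =
      exp ((ℓ : ℚ_[ℓ]) ^ s • a.map ((↑) : ℤ_[ℓ] → ℚ_[ℓ])) :=
  exists_mem_congruenceSubgroup_map_eq_exp hs (box_smul_map_coe s a)

/-- Every `g ∈ Γ(ℓˢ)` is `exp (ℓˢ ι(a))` for some (unique) `a ∈ M₂(ℤ_ℓ)` (`s ≥ 3`): the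
`ℓ`-adic logarithm, used only through this existence statement. [folklore] -/
theorem exists_map_eq_exp_smul_map_of_mem {s : ℕ} (hs : 3 ≤ s) {g : GL (Fin 2) ℤ_[ℓ]}
    (hg : g ∈ GL2.congruenceSubgroup (p := ℓ) s) :
    ∃ a : Matrix (Fin 2) (Fin 2) ℤ_[ℓ], (g : Matrix (Fin 2) (Fin 2) ℤ_[ℓ]).map ((↑) : ℤ_[ℓ] → ℚ_[ℓ]) =
      exp ((ℓ : ℚ_[ℓ]) ^ s • a.map ((↑) : ℤ_[ℓ] → ℚ_[ℓ])) := by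
  obtain ⟨A, hA, hAg⟩ := exists_box_exp_eq_of_mem_congruenceSubgroup hs hg
  obtain ⟨a, rfl⟩ := exists_eq_smul_map_of_box hA
  exact ⟨a, hAg.symm⟩

/-- **First-order congruence, integral form.**  If `ι(g) = exp (ℓˢ ι(a))` (`s ≥ 3`) then
`g = 1 + ℓˢ a + ℓ^{2s−1} r` for some integral `r`; in particular `g ≡ 1 + ℓˢ a (mod ℓ^{s+2})`
(as `2s − 1 ≥ s + 2`). [folklore] -/
theorem exists_eq_one_add_smul_add_of_map_eq_exp {s : ℕ} (hs : 3 ≤ s) {g : GL (Fin 2) ℤ_[ℓ]}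
    {a : Matrix (Fin 2) (Fin 2) ℤ_[ℓ]}
    (h : (g : Matrix (Fin 2) (Fin 2) ℤ_[ℓ]).map ((↑) : ℤ_[ℓ] → ℚ_[ℓ]) =
      exp ((ℓ : ℚ_[ℓ]) ^ s • a.map ((↑) : ℤ_[ℓ] → ℚ_[ℓ]))) :
    ∃ r : Matrix (Fin 2) (Fin 2) ℤ_[ℓ],
      (g : Matrix (Fin 2) (Fin 2) ℤ_[ℓ]) = 1 + (ℓ : ℤ_[ℓ]) ^ s • a + (ℓ : ℤ_[ℓ]) ^ (2 * s - 1) • r := by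
  obtain ⟨r, hr⟩ := exists_eq_smul_map_of_box (box_exp_sub_one_sub hs (box_smul_map_coe s a))
  have he : exp ((ℓ : ℚ_[ℓ]) ^ s • a.map ((↑) : ℤ_[ℓ] → ℚ_[ℓ])) =
      1 + (ℓ : ℚ_[ℓ]) ^ s • a.map ((↑) : ℤ_[ℓ] → ℚ_[ℓ]) + (ℓ : ℚ_[ℓ]) ^ (2 * s - 1) • r.map ((↑) : ℤ_[ℓ] → ℚ_[ℓ]) := by
    rw [← hr]; abel
  have key : (g : Matrix (Fin 2) (Fin 2) ℤ_[ℓ]).map ((↑) : ℤ_[ℓ] → ℚ_[ℓ]) =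
      (1 + (ℓ : ℤ_[ℓ]) ^ s • a + (ℓ : ℤ_[ℓ]) ^ (2 * s - 1) • r).map ((↑) : ℤ_[ℓ] → ℚ_[ℓ]) := by
    rw [h, he]
    ext i j
    by_cases hij : i = j
    · subst hij; simp
    · simp [Matrix.one_apply_ne hij]
  exact ⟨r, Matrix.map_injective Subtype.val_injective key⟩

/-- Hence `g ≡ 1 + ℓˢ a (mod ℓᵗ)` for every `t ≤ 2s − 1`. [folklore] -/
theorem map_toZModPow_eq_of_map_eq_exp {s t : ℕ} (hs : 3 ≤ s) (ht : t ≤ 2 * s - 1) {g : GL (Fin 2) ℤ_[ℓ]}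
    {a : Matrix (Fin 2) (Fin 2) ℤ_[ℓ]}
    (h : (g : Matrix (Fin 2) (Fin 2) ℤ_[ℓ]).map ((↑) : ℤ_[ℓ] → ℚ_[ℓ]) =
      exp ((ℓ : ℚ_[ℓ]) ^ s • a.map ((↑) : ℤ_[ℓ] → ℚ_[ℓ]))) :
    (g : Matrix (Fin 2) (Fin 2) ℤ_[ℓ]).map (PadicInt.toZModPow t) =
      (1 + (ℓ : ℤ_[ℓ]) ^ s • a).map (PadicInt.toZModPow t) := by
  obtain ⟨r, hr⟩ := exists_eq_one_add_smul_add_of_map_eq_exp hs h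
  rw [hr, map_add_smul_pow_eq ht]

/-- … and `g ∈ Γ(ℓˢ)`. [folklore] -/
theorem mem_congruenceSubgroup_of_map_eq_exp {s : ℕ} (hs : 3 ≤ s) {g : GL (Fin 2) ℤ_[ℓ]}
    {a : Matrix (Fin 2) (Fin 2) ℤ_[ℓ]}
    (h : (g : Matrix (Fin 2) (Fin 2) ℤ_[ℓ]).map ((↑) : ℤ_[ℓ] → ℚ_[ℓ]) =
      exp ((ℓ : ℚ_[ℓ]) ^ s • a.map ((↑) : ℤ_[ℓ] → ℚ_[ℓ]))) :
    g ∈ GL2.congruenceSubgroup (p := ℓ) s := by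
  rw [mem_congruenceSubgroup_iff_map_eq, map_toZModPow_eq_of_map_eq_exp hs (by omega) h,
    Matrix.map_add (PadicInt.toZModPow s) (map_add _), map_smul_pow_eq_zero le_rfl, add_zero,
    Matrix.map_one _ (map_zero _) (map_one _)]

end OpenImage

end Literature.NumberTheory.EllipticCurves.ModularForms
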